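import Mathlib
import Summits.CriticalPhenomena.PercolationContinuityZ3.Theorems.PercNearOneGluingNoHeavyLowerTailOrderedDifferencesTwoChain

/-!
# Type proxies: 2-chain periodicity beyond subset-closed difference families, and two-sided interval certificates

Helper file for crux `stmt-CriticalPhenomena-4575` (`NoHeavyLowerTail`, route `PercNearOneGluingNoHeavy`),
new-inequality factory seat `prim-ineq-gen-3` (gen 23).  Everything here is PROVED; no definitions.

Notation (memo `run/shared/lean/prim/prim-ineq-gen-3/CONJECTURE-P2.md`): `D = 𝒜 \\ 𝒜`, `Z C E = [E ⊆ C]`,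
`Y C E = [E ∩ C = ∅]` (`C ∈ 𝒜`, `E ∈ D`); a relation is `λ Z = μ Y`; P2 says `λ → μ → ν` forces `λ = ν`.
The matrices `Z`, `Y` see a column `E` only through its TYPE `(𝒰_E, 𝒱_E) = ({C ⊇ E}, {C : C ∩ E = ∅})`.  A PROXY for an
arbitrary set `F` is a column `π F ∈ D` of the same type.

* `twoChain_of_proxy` — if every subset `F` of every column `E ∈ D` has a proxy `π F ∈ D`, then P2 holds over every
  field.  [`μ Y(E) = ∑_{F ⊆ E} (-1)^{#F} μ Z(F) = ∑_F (-1)^{#F} μ Z(π F) = ∑_F (-1)^{#F} ν Y(π F) = ∑_F (-1)^{#F} ν Y(F)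
  = ν Z(E)`, then Marica–Schönheim.]  The case `π = id` is `twoChain_of_diffs_downClosed` (gen 21); proxies add e.g. all
  matchings (families of pairwise disjoint sets), sunflowers whose petals avoid the other members, and ≈ 12 % of random
  families on ≤ 7 points (memo FINDINGS-gen23.md).
* `linearIndependent_pencil_of_proxy` — hence the pencil rows `[E ⊆ C] + t [E ∩ C = ∅]` are independent for `t * t ≠ 1`.
* `certificate_of_interval_proxy` — ★ the TWO-SIDED INTERVAL CERTIFICATE: for disjoint `X, Y`, if the Boolean intervals
  `{X ∪ F : F ⊆ Y}` and `{Y ∪ G : G ⊆ X}` consist of sets having proxies in `ℬ \\ ℬ`, then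
  `p = ∑_{F ⊆ Y} (-1)^{#F} e_{π(X ∪ F)}`, `q = ∑_{G ⊆ X} (-1)^{#G} e_{π(Y ∪ G)}` is a reciprocal pair with
  `Z p = Y q = 𝟙{C : X ⊆ C, C ∩ Y = ∅}` and `Y p = Z q = 𝟙{C : Y ⊆ C, C ∩ X = ∅}`; so if `A` is the only member of `ℬ`
  containing `X` and avoiding `Y`, this certifies `A` (in the form consumed by `twoChain_of_certificates` and
  `linearIndependent_pencil_of_certificates`).  `Y = ∅, π = id` is gen 22's `certificate_of_powerset_subset_of_subset_iff`,
  `X = ∅` its dual; `X = {x}, Y = {y}` is the pair `(e_x - e_{xy}, e_y - e_{xy})`.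
* `certificate_of_interval` — the proxy-free special case (`π = id`).
(prim-ineq-gen-3 gen 23, 2026-08-24.)
-/

namespace Summit.CriticalPhenomena.PercolationContinuityZ3.Theorems

namespace OrderedDifferences

open Finset
open scoped FinsetFamily

variable {α : Type*} [DecidableEq α] {K : Type*} [Field K]

/-- **2-chain periodicity from type proxies.**  Suppose that for every column `E ∈ 𝒜 \\ 𝒜` and every `F ⊆ E` the set
`π F` is a column of `𝒜 \\ 𝒜` with the same containment and disjointness pattern as `F` against the members of `𝒜`.
Then `λ Z = μ Y` and `μ Z = ν Y` on `𝒜 \\ 𝒜` force `λ = ν` (over any field). -/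
theorem twoChain_of_proxy (𝒜 : Finset (Finset α)) (π : Finset α → Finset α)
    (hπ : ∀ E ∈ 𝒜 \\ 𝒜, ∀ F, F ⊆ E → π F ∈ 𝒜 \\ 𝒜 ∧
      (∀ A ∈ 𝒜, π F ⊆ A ↔ F ⊆ A) ∧ (∀ A ∈ 𝒜, Disjoint (π F) A ↔ Disjoint F A))
    (l m n : ↥𝒜 → K)
    (h1 : ∀ E ∈ 𝒜 \\ 𝒜, ∑ A : 𝒜, l A * (if E ⊆ (A : Finset α) then (1 : K) else 0) =
        ∑ A : 𝒜, m A * (if Disjoint E (A : Finset α) then (1 : K) else 0))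
    (h2 : ∀ E ∈ 𝒜 \\ 𝒜, ∑ A : 𝒜, m A * (if E ⊆ (A : Finset α) then (1 : K) else 0) =
        ∑ A : 𝒜, n A * (if Disjoint E (A : Finset α) then (1 : K) else 0)) : l = n := by
  classical
  -- `μ Z(F) = μ Z(π F) = ν Y(π F) = ν Y(F)` for every subset `F` of a column `E`
  have h2' : ∀ E ∈ 𝒜 \\ 𝒜, ∀ F ∈ E.powerset,
      ∑ A : 𝒜, m A * (if F ⊆ (A : Finset α) then (1 : K) else 0) =
        ∑ A : 𝒜, n A * (if Disjoint F (A : Finset α) then (1 : K) else 0) := by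
    intro E hE F hF
    obtain ⟨hmem, hsub, hdis⟩ := hπ E hE F (mem_powerset.mp hF)
    calc ∑ A : 𝒜, m A * (if F ⊆ (A : Finset α) then (1 : K) else 0)
        = ∑ A : 𝒜, m A * (if π F ⊆ (A : Finset α) then (1 : K) else 0) :=
          sum_congr rfl fun A _ => by rw [if_congr (hsub A A.2) rfl rfl]
      _ = ∑ A : 𝒜, n A * (if Disjoint (π F) (A : Finset α) then (1 : K) else 0) := h2 (π F) hmem
      _ = ∑ A : 𝒜, n A * (if Disjoint F (A : Finset α) then (1 : K) else 0) :=
          sum_congr rfl fun A _ => by rw [if_congr (hdis A A.2) rfl rfl]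
  -- `μ Y = ν Z` on `𝒜 \\ 𝒜`
  have h3 : ∀ E ∈ 𝒜 \\ 𝒜, ∑ A : 𝒜, m A * (if Disjoint E (A : Finset α) then (1 : K) else 0) =
      ∑ A : 𝒜, n A * (if E ⊆ (A : Finset α) then (1 : K) else 0) := by
    intro E hE
    calc ∑ A : 𝒜, m A * (if Disjoint E (A : Finset α) then (1 : K) else 0)
        = ∑ A : 𝒜, m A * ∑ F ∈ E.powerset, (-1 : K) ^ #F * (if F ⊆ (A : Finset α) then (1 : K) else 0) := by
          refine sum_congr rfl fun A _ => ?_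
          rw [sum_powerset_neg_one_pow_mul_subset]
      _ = ∑ F ∈ E.powerset, (-1 : K) ^ #F * ∑ A : 𝒜, m A * (if F ⊆ (A : Finset α) then (1 : K) else 0) := by
          simp_rw [mul_sum]
          rw [sum_comm]
          refine sum_congr rfl fun F _ => sum_congr rfl fun A _ => ?_
          ring
      _ = ∑ F ∈ E.powerset, (-1 : K) ^ #F * ∑ A : 𝒜, n A * (if Disjoint F (A : Finset α) then (1 : K) else 0) := by
          refine sum_congr rfl fun F hF => ?_
          rw [h2' E hE F hF]
      _ = ∑ A : 𝒜, n A * ∑ F ∈ E.powerset, (-1 : K) ^ #F * (if Disjoint F (A : Finset α) then (1 : K) else 0) := by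
          simp_rw [mul_sum]
          rw [sum_comm]
          refine sum_congr rfl fun A _ => sum_congr rfl fun F _ => ?_
          ring
      _ = ∑ A : 𝒜, n A * (if E ⊆ (A : Finset α) then (1 : K) else 0) := by
          refine sum_congr rfl fun A _ => ?_
          rw [sum_powerset_neg_one_pow_mul_disjoint]
  -- hence `(λ - ν) Z = 0` on `𝒜 \\ 𝒜`, and Marica–Schönheim over `K` gives `λ = ν`
  have h4 := eq_zero_of_sum_incidence_diffs_eq_zero (K := K) 𝒜 (fun A => l A - n A) (by
    intro E hE
    have e : ∑ A : 𝒜, (l A - n A) * (if E ⊆ (A : Finset α) then (1 : K) else 0) =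
        ∑ A : 𝒜, l A * (if E ⊆ (A : Finset α) then (1 : K) else 0) -
          ∑ A : 𝒜, n A * (if E ⊆ (A : Finset α) then (1 : K) else 0) := by
      rw [← sum_sub_distrib]; refine sum_congr rfl fun A _ => ?_; ring
    rw [e, h1 E hE, h3 E hE, sub_self])
  funext A
  have := congr_fun h4 A
  simp only [Pi.zero_apply] at this
  linear_combination this

/-- **MS-PENCIL over every field from type proxies.**  Under the hypothesis of `twoChain_of_proxy`, for every field `K` and
every `t ∈ K` with `t * t ≠ 1` the pencil rows `A ↦ (E ↦ [E ⊆ A] + t [E ∩ A = ∅])` over `𝒜 \\ 𝒜` are linearly independent. -/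
theorem linearIndependent_pencil_of_proxy (𝒜 : Finset (Finset α)) (π : Finset α → Finset α)
    (hπ : ∀ E ∈ 𝒜 \\ 𝒜, ∀ F, F ⊆ E → π F ∈ 𝒜 \\ 𝒜 ∧
      (∀ A ∈ 𝒜, π F ⊆ A ↔ F ⊆ A) ∧ (∀ A ∈ 𝒜, Disjoint (π F) A ↔ Disjoint F A))
    {t : K} (ht : t * t ≠ 1) :
    LinearIndependent K (fun A : 𝒜 => fun E : (𝒜 \\ 𝒜 : Finset (Finset α)) =>
      (if (E : Finset α) ⊆ (A : Finset α) then (1 : K) else 0) +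
        t * (if Disjoint (E : Finset α) (A : Finset α) then (1 : K) else 0)) :=
  linearIndependent_pencil_of_twoChain 𝒜 (fun l m n h1 h2 => twoChain_of_proxy 𝒜 π hπ l m n h1 h2) ht

/-- Evaluation of an alternating sum of proxy columns against a test function `g` on the columns. -/
private theorem sum_proxy_powerset_aux (ℬ : Finset (Finset α)) (T : Finset α) (c : Finset α → Finset α)
    (hc : ∀ F ∈ T.powerset, c F ∈ ℬ \\ ℬ) (g : Finset α → K) :
    ∑ W ∈ ℬ \\ ℬ, (∑ F ∈ T.powerset, if W = c F then (-1 : K) ^ #F else 0) * g W =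
      ∑ F ∈ T.powerset, (-1 : K) ^ #F * g (c F) := by
  calc ∑ W ∈ ℬ \\ ℬ, (∑ F ∈ T.powerset, if W = c F then (-1 : K) ^ #F else 0) * g W
      = ∑ W ∈ ℬ \\ ℬ, ∑ F ∈ T.powerset, (if W = c F then (-1 : K) ^ #F else 0) * g W := by
        refine sum_congr rfl fun W _ => ?_
        rw [sum_mul]
    _ = ∑ F ∈ T.powerset, ∑ W ∈ ℬ \\ ℬ, (if W = c F then (-1 : K) ^ #F else 0) * g W := sum_comm
    _ = ∑ F ∈ T.powerset, (-1 : K) ^ #F * g (c F) := by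
        refine sum_congr rfl fun F hF => ?_
        simp_rw [ite_mul, zero_mul]
        rw [sum_ite_eq' (ℬ \\ ℬ) (c F), if_pos (hc F hF)]

/-- `∑_{F ⊆ Y} (-1)^{#F} [X ∪ F ⊆ C] = [X ⊆ C] [Y ∩ C = ∅]`. -/
private theorem sum_powerset_union_subset (X Y C : Finset α) :
    ∑ F ∈ Y.powerset, (-1 : K) ^ #F * (if X ∪ F ⊆ C then (1 : K) else 0) =
      if X ⊆ C ∧ Disjoint Y C then 1 else 0 := by
  by_cases hX : X ⊆ C
  · have e : ∀ F ∈ Y.powerset, (-1 : K) ^ #F * (if X ∪ F ⊆ C then (1 : K) else 0) =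
        (-1 : K) ^ #F * (if F ⊆ C then (1 : K) else 0) := fun F _ => by
      rw [if_congr (union_subset_iff.trans (and_iff_right hX)) rfl rfl]
    rw [sum_congr rfl e, sum_powerset_neg_one_pow_mul_subset]
    by_cases hY : Disjoint Y C
    · rw [if_pos hY, if_pos ⟨hX, hY⟩]
    · rw [if_neg hY, if_neg (fun h => hY h.2)]
  · have e : ∀ F ∈ Y.powerset, (-1 : K) ^ #F * (if X ∪ F ⊆ C then (1 : K) else 0) = 0 := fun F _ => by
      rw [if_neg (fun h => hX (union_subset_iff.mp h).1), mul_zero]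
    rw [sum_congr rfl e, sum_const_zero, if_neg (fun h => hX h.1)]

/-- `∑_{F ⊆ Y} (-1)^{#F} [(X ∪ F) ∩ C = ∅] = [X ∩ C = ∅] [Y ⊆ C]`. -/
private theorem sum_powerset_union_disjoint (X Y C : Finset α) :
    ∑ F ∈ Y.powerset, (-1 : K) ^ #F * (if Disjoint (X ∪ F) C then (1 : K) else 0) =
      if Y ⊆ C ∧ Disjoint X C then 1 else 0 := by
  by_cases hX : Disjoint X C
  · have e : ∀ F ∈ Y.powerset, (-1 : K) ^ #F * (if Disjoint (X ∪ F) C then (1 : K) else 0) =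
        (-1 : K) ^ #F * (if Disjoint F C then (1 : K) else 0) := fun F _ => by
      rw [if_congr (disjoint_union_left.trans (and_iff_right hX)) rfl rfl]
    rw [sum_congr rfl e, sum_powerset_neg_one_pow_mul_disjoint]
    by_cases hY : Y ⊆ C
    · rw [if_pos hY, if_pos ⟨hY, hX⟩]
    · rw [if_neg hY, if_neg (fun h => hY h.1)]
  · have e : ∀ F ∈ Y.powerset, (-1 : K) ^ #F * (if Disjoint (X ∪ F) C then (1 : K) else 0) = 0 := fun F _ => by
      rw [if_neg (fun h => hX (disjoint_union_left.mp h).1), mul_zero]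
    rw [sum_congr rfl e, sum_const_zero, if_neg (fun h => hX h.2)]

/-- **Two-sided interval certificate with proxies.**  Let `X, Y` be finite sets and `π` a map such that every set
`X ∪ F` (`F ⊆ Y`) and every set `Y ∪ G` (`G ⊆ X`) is sent to a column of `ℬ \\ ℬ` with the same containment and
disjointness pattern against the members of `ℬ`.  If `A` is the only member of `ℬ` that contains `X` and avoids `Y`,
then `p = ∑_{F ⊆ Y} (-1)^{#F} e_{π (X ∪ F)}`, `q = ∑_{G ⊆ X} (-1)^{#G} e_{π (Y ∪ G)}` is a reciprocal certificate
for `A`: `Z p = δ_A = Y q` and `Y p = Z q` (`= 𝟙{C : Y ⊆ C, C ∩ X = ∅}`). -/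
theorem certificate_of_interval_proxy (ℬ : Finset (Finset α)) (A X Y : Finset α) (π : Finset α → Finset α)
    (hX : ∀ F, F ⊆ Y → π (X ∪ F) ∈ ℬ \\ ℬ ∧
      (∀ C ∈ ℬ, π (X ∪ F) ⊆ C ↔ X ∪ F ⊆ C) ∧ (∀ C ∈ ℬ, Disjoint (π (X ∪ F)) C ↔ Disjoint (X ∪ F) C))
    (hY : ∀ G, G ⊆ X → π (Y ∪ G) ∈ ℬ \\ ℬ ∧
      (∀ C ∈ ℬ, π (Y ∪ G) ⊆ C ↔ Y ∪ G ⊆ C) ∧ (∀ C ∈ ℬ, Disjoint (π (Y ∪ G)) C ↔ Disjoint (Y ∪ G) C))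
    (hA : ∀ C ∈ ℬ, (X ⊆ C ∧ Disjoint Y C) ↔ C = A) :
    ∃ p q : Finset α → K,
      (∀ C ∈ ℬ, ∑ W ∈ ℬ \\ ℬ, p W * (if W ⊆ C then (1 : K) else 0) = if C = A then 1 else 0) ∧
      (∀ C ∈ ℬ, ∑ W ∈ ℬ \\ ℬ, q W * (if Disjoint W C then (1 : K) else 0) = if C = A then 1 else 0) ∧
      (∀ C ∈ ℬ, ∑ W ∈ ℬ \\ ℬ, p W * (if Disjoint W C then (1 : K) else 0) =
        ∑ W ∈ ℬ \\ ℬ, q W * (if W ⊆ C then (1 : K) else 0)) := by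
  classical
  have hcX : ∀ F ∈ Y.powerset, π (X ∪ F) ∈ ℬ \\ ℬ := fun F hF => (hX F (mem_powerset.mp hF)).1
  have hcY : ∀ G ∈ X.powerset, π (Y ∪ G) ∈ ℬ \\ ℬ := fun G hG => (hY G (mem_powerset.mp hG)).1
  refine ⟨fun W => ∑ F ∈ Y.powerset, if W = π (X ∪ F) then (-1 : K) ^ #F else 0,
    fun W => ∑ G ∈ X.powerset, if W = π (Y ∪ G) then (-1 : K) ^ #G else 0, ?_, ?_, ?_⟩
  · -- `Z p (C) = ∑_{F ⊆ Y} (-1)^{#F} [X ∪ F ⊆ C] = [X ⊆ C, Y ∩ C = ∅] = [C = A]`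
    intro C hC
    rw [sum_proxy_powerset_aux ℬ Y (fun F => π (X ∪ F)) hcX]
    have e : ∀ F ∈ Y.powerset, (-1 : K) ^ #F * (if π (X ∪ F) ⊆ C then (1 : K) else 0) =
        (-1 : K) ^ #F * (if X ∪ F ⊆ C then (1 : K) else 0) := fun F hF => by
      rw [if_congr ((hX F (mem_powerset.mp hF)).2.1 C hC) rfl rfl]
    rw [sum_congr rfl e, sum_powerset_union_subset, if_congr (hA C hC) rfl rfl]
  · -- `Y q (C) = ∑_{G ⊆ X} (-1)^{#G} [(Y ∪ G) ∩ C = ∅] = [X ⊆ C, Y ∩ C = ∅] = [C = A]`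
    intro C hC
    rw [sum_proxy_powerset_aux ℬ X (fun G => π (Y ∪ G)) hcY]
    have e : ∀ G ∈ X.powerset, (-1 : K) ^ #G * (if Disjoint (π (Y ∪ G)) C then (1 : K) else 0) =
        (-1 : K) ^ #G * (if Disjoint (Y ∪ G) C then (1 : K) else 0) := fun G hG => by
      rw [if_congr ((hY G (mem_powerset.mp hG)).2.2 C hC) rfl rfl]
    rw [sum_congr rfl e, sum_powerset_union_disjoint, if_congr (hA C hC) rfl rfl]
  · -- `Y p (C) = [Y ⊆ C, X ∩ C = ∅] = Z q (C)`
    intro C hC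
    rw [sum_proxy_powerset_aux ℬ Y (fun F => π (X ∪ F)) hcX,
      sum_proxy_powerset_aux ℬ X (fun G => π (Y ∪ G)) hcY]
    have e1 : ∀ F ∈ Y.powerset, (-1 : K) ^ #F * (if Disjoint (π (X ∪ F)) C then (1 : K) else 0) =
        (-1 : K) ^ #F * (if Disjoint (X ∪ F) C then (1 : K) else 0) := fun F hF => by
      rw [if_congr ((hX F (mem_powerset.mp hF)).2.2 C hC) rfl rfl]
    have e2 : ∀ G ∈ X.powerset, (-1 : K) ^ #G * (if π (Y ∪ G) ⊆ C then (1 : K) else 0) =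
        (-1 : K) ^ #G * (if Y ∪ G ⊆ C then (1 : K) else 0) := fun G hG => by
      rw [if_congr ((hY G (mem_powerset.mp hG)).2.1 C hC) rfl rfl]
    rw [sum_congr rfl e1, sum_congr rfl e2, sum_powerset_union_disjoint, sum_powerset_union_subset]

/-- **Two-sided interval certificate (no proxies).**  If for disjoint-pattern data `X, Y` all the sets `X ∪ F` (`F ⊆ Y`)
and `Y ∪ G` (`G ⊆ X`) are columns of `ℬ \\ ℬ` and `A` is the only member containing `X` and avoiding `Y`, then
`p = ∑_{F ⊆ Y} (-1)^{#F} e_{X ∪ F}`, `q = ∑_{G ⊆ X} (-1)^{#G} e_{Y ∪ G}` is a reciprocal certificate for `A`.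
[`Y = ∅`: gen 22's unique-container Möbius certificate; `X = ∅`: its dual; `X = {x}`, `Y = {y}`: the pair
`(e_{x} - e_{xy}, e_{y} - e_{xy})`.] -/
theorem certificate_of_interval (ℬ : Finset (Finset α)) (A X Y : Finset α)
    (hX : ∀ F, F ⊆ Y → X ∪ F ∈ ℬ \\ ℬ) (hY : ∀ G, G ⊆ X → Y ∪ G ∈ ℬ \\ ℬ)
    (hA : ∀ C ∈ ℬ, (X ⊆ C ∧ Disjoint Y C) ↔ C = A) :
    ∃ p q : Finset α → K,
      (∀ C ∈ ℬ, ∑ W ∈ ℬ \\ ℬ, p W * (if W ⊆ C then (1 : K) else 0) = if C = A then 1 else 0) ∧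
      (∀ C ∈ ℬ, ∑ W ∈ ℬ \\ ℬ, q W * (if Disjoint W C then (1 : K) else 0) = if C = A then 1 else 0) ∧
      (∀ C ∈ ℬ, ∑ W ∈ ℬ \\ ℬ, p W * (if Disjoint W C then (1 : K) else 0) =
        ∑ W ∈ ℬ \\ ℬ, q W * (if W ⊆ C then (1 : K) else 0)) :=
  certificate_of_interval_proxy ℬ A X Y id
    (fun F hF => ⟨hX F hF, fun _ _ => Iff.rfl, fun _ _ => Iff.rfl⟩)
    (fun G hG => ⟨hY G hG, fun _ _ => Iff.rfl, fun _ _ => Iff.rfl⟩) hA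

end OrderedDifferences

end Summit.CriticalPhenomena.PercolationContinuityZ3.Theorems
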